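import Literature.NumberTheory.Transcendental.KZLogCalculusProofs

/-!
# `UnfoldedLogStokes` (stmt-KontsevichZagierPeriods-2835) — line `engine-transport`,
stub `stub_nullNormalise` (null-normalisation congruence)

The tree engine `KZ.unfoldedLogStokes_mem_relations` pins the integrands of its representations on
the WHOLE band, whereas the crux pins `r₄`, `r₁` only at interior points; line `engine-transport`
swaps each crux representation for a twin agreeing with it off a Lebesgue-null `ℚ`-semialgebraic set
`N`. This stub is that congruence: two KZ representations `r`, `r'` on the same domain whose
integrands agree on `r.domain \ N`, `N` null and `ℚ`-semialgebraic, differ by a relation. Proof: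
rule 1a) twice (`KZ.domainAddRel_subset_relations`: split each of `r`, `r'` into its restrictions to
`domain \ N` and `domain ∩ N`), congruence on the good parts (`KZ.of_sub_of_mem_relations_of_eqOn`),
null-domain junk on the bad parts (`KZ.of_mem_relations_of_volume_eq_zero`). [folklore]
-/

noncomputable section

open MeasureTheory Set
open Literature.NumberTheory.Transcendental
open Literature.ModelTheory.ExponentialFields (IsSemialgebraic)

namespace Summit.KontsevichZagierPeriods.LiouvilleUnfolding.Engine

/-- **Stub — null-normalisation congruence.** Two KZ integral representations `r`, `r'` with the
same domain whose integrands agree off a Lebesgue-null `ℚ`-semialgebraic set `N` differ by a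
relation of the Kontsevich–Zagier calculus: rule 1a) twice (restrict both representations to the
good part `domain \ N` and to the null part `domain ∩ N`, `KZ.domainAddRel_subset_relations`),
congruence on the good part (`KZ.of_sub_of_mem_relations_of_eqOn`) and null-domain junk on the bad
part (`KZ.of_mem_relations_of_volume_eq_zero`). [folklore] -/
theorem stub_nullNormalise : ∀ (n : ℕ) (r r' : Literature.NumberTheory.Transcendental.KZ.IntegralRep n) (N : Set (Fin n → ℝ)), r'.domain = r.domain → Literature.ModelTheory.ExponentialFields.IsSemialgebraic ℚ N → MeasureTheory.volume N = 0 → Set.EqOn r.integrand r'.integrand (r.domain \ N) → Literature.NumberTheory.Transcendental.KZ.of r - Literature.NumberTheory.Transcendental.KZ.of r' ∈ Literature.NumberTheory.Transcendental.KZ.relations := by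
  intro n r r' N hd hN hN0 h
  have hσ := r.isSemialgebraic_domain
  have hgood : IsSemialgebraic ℚ (r.domain \ N) := hσ.diff hN
  have hbad : IsSemialgebraic ℚ (r.domain ∩ N) := hσ.inter hN
  have hsub₀ : r.domain \ N ⊆ r.domain := Set.sdiff_subset
  have hsub₁ : r.domain \ N ⊆ r'.domain := by rw [hd]; exact Set.sdiff_subset
  have hsub₂ : r.domain ∩ N ⊆ r'.domain := by rw [hd]; exact inter_subset_left
  have hdec : r.domain = (r.domain \ N) ∪ (r.domain ∩ N) := (Set.sdiff_union_inter _ _).symm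
  have hdisj : (r.domain \ N) ∩ (r.domain ∩ N) = ∅ := Set.disjoint_sdiff_inter.inter_eq
  have hnull : volume ((r.domain \ N) ∩ (r.domain ∩ N)) = 0 := by rw [hdisj, measure_empty]
  have h1 : KZ.of r - KZ.of (r.restrict _ hgood hsub₀) -
      KZ.of (r.restrict _ hbad inter_subset_left) ∈ KZ.relations := by
    refine KZ.domainAddRel_subset_relations ⟨n, r, r.restrict _ hgood hsub₀,
      r.restrict _ hbad inter_subset_left, ?_, ?_, fun _ _ => rfl, fun _ _ => rfl, rfl⟩
    · simpa only [KZ.IntegralRep.domain_restrict] using hdec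
    · simpa only [KZ.IntegralRep.domain_restrict] using hnull
  have h2 : KZ.of r' - KZ.of (r'.restrict _ hgood hsub₁) -
      KZ.of (r'.restrict _ hbad hsub₂) ∈ KZ.relations := by
    refine KZ.domainAddRel_subset_relations ⟨n, r', r'.restrict _ hgood hsub₁,
      r'.restrict _ hbad hsub₂, ?_, ?_, fun _ _ => rfl, fun _ _ => rfl, rfl⟩
    · simpa only [KZ.IntegralRep.domain_restrict, hd] using hdec
    · simpa only [KZ.IntegralRep.domain_restrict] using hnull
  have h3 : KZ.of (r.restrict _ hgood hsub₀) - KZ.of (r'.restrict _ hgood hsub₁) ∈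
      KZ.relations :=
    KZ.of_sub_of_mem_relations_of_eqOn rfl (fun x hx => h hx)
  have h4 : KZ.of (r.restrict _ hbad inter_subset_left) ∈ KZ.relations :=
    KZ.of_mem_relations_of_volume_eq_zero _ (measure_mono_null inter_subset_right hN0)
  have h5 : KZ.of (r'.restrict _ hbad hsub₂) ∈ KZ.relations :=
    KZ.of_mem_relations_of_volume_eq_zero _ (measure_mono_null inter_subset_right hN0)
  have key : KZ.of r - KZ.of r' =
      (KZ.of r - KZ.of (r.restrict _ hgood hsub₀) - KZ.of (r.restrict _ hbad inter_subset_left)) -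
      (KZ.of r' - KZ.of (r'.restrict _ hgood hsub₁) - KZ.of (r'.restrict _ hbad hsub₂)) +
      (KZ.of (r.restrict _ hgood hsub₀) - KZ.of (r'.restrict _ hgood hsub₁)) +
      KZ.of (r.restrict _ hbad inter_subset_left) - KZ.of (r'.restrict _ hbad hsub₂) := by abel
  rw [key]
  exact KZ.relations.sub_mem (KZ.relations.add_mem (KZ.relations.add_mem
    (KZ.relations.sub_mem h1 h2) h3) h4) h5

end Summit.KontsevichZagierPeriods.LiouvilleUnfolding.Engine

end
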